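import Literature.Topology.FourManifolds.TrisectionsTopHeightBot
import Literature.Topology.FourManifolds.TrisectionsSectorWeight
import HarnessLib

/-!
# The second sector's function: definition, smoothness on the band, and its local forms

Topic `Literature/Topology/FourManifolds`; step E4c (part ii-a) of a Morse-theoretic
construction of Gay–Kirby's trisection for the fact seat
`provefact-Literature.Topology.FourManifolds.exists_isBalancedGKTrisection` (Gay–Kirby 2016,
Thm. 4 via §4, Lemma 14).  Everything in this file is **proved**; the definitions are explicit.

The function of the second sector `X₂ = {0 ≤ s ≤ T}` (`s = f - a`, `T = T_bot` the top height
of `TrisectionsTopHeightBot.lean`) is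

  `ψ₂ = 1 - C · s · (T - s) · W · R`

with the weight `W` and the radial correction `R` of `TrisectionsSectorWeight.lean`
(`HandleBoxes.psiTwo`).  This file proves that `Ψ₂ = s (T - s) W R` is smooth on the band
(`contMDiffAt_psiTwoRaw`) and identifies it locally with the explicit recipes of the three
regimes of the critical-point analysis:

* **flow-rule region** (plateau of the band, hitting points, `P_j > 2P₁`, `A_j > a_R/2`,
  `A_j > a_R'` on the chart domains): `T = h₂(φ̄)`, `W = w(φ̄)`, `R = 1` near the point, so
  `Ψ₂ = Γ₂(φ̄, f)` near it with `Γ₂(p, q) = (q - a)(h₂(p) - (q - a)) w(p)`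
  (`psiTwoRaw_eventuallyEq_flowRule`);
* the identities `T = T_P(P_j)` on `source_j ∩ {P_j < 2P_sw}` (plateau) and `W = w(c₀ 𝒯(coord_j))`
  on `source_j ∩ {a_R/2 < A_j < η}` (band), `R = 1` on `{A_j ≥ a_R'}` — the inputs of the
  tube-saturation and chart-zone regimes (`topHeightBot_eq_TP`, `weight_eq_w_tube`).

## References

* D. Gay, R. Kirby, *Trisecting 4-manifolds*, Geom. Topol. 20 (2016), §4, Lemma 14. [GayKirby2016]
* J. Milnor, *Lectures on the h-cobordism theorem* (1965), Def. 3.1, Thm. 3.12, Thm. 4.1. [MilnorHCobordism1965]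
-/

open scoped Manifold ContDiff Topology
open Set Function Filter Metric

noncomputable section

universe u

namespace Literature.Topology.FourManifolds

open Flow

/-- Local notation: `𝔼 n` is the model Euclidean space `EuclideanSpace ℝ (Fin n)`. -/
local notation "𝔼 " n:arg => EuclideanSpace ℝ (Fin n)

variable {X : Type u} [TopologicalSpace X] [T2Space X] [CompactSpace X] [ChartedSpace (𝔼 4) X]
  [IsManifold (𝓡 4) ∞ X]
  {f : X → ℝ} {ξ : Π x : X, TangentSpace (𝓡 4) x} {a η : ℝ} {ι : Type} [Fintype ι]
  (H : HandleBoxes f ξ a η ι)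
  {hξ : ContMDiff (𝓡 4) (𝓡 4).tangent ∞ fun x => (⟨x, ξ x⟩ : TangentBundle (𝓡 4) X)}
  {h : IsRegularLevel (𝓡 4) f a} {φ : RegularLevel h → ℝ} {h₂ TP χlo χhi w ρ R₀ : ℝ → ℝ}
  {Spl Sbot Smin Psw c₀ ε κ aR : ℝ}

namespace HandleBoxes

/-! ### Definition and smoothness -/

/-- **`Ψ₂ = s · (T - s) · W · R`.** [cite: GayKirby2016, §4, Lemma 14] -/
def psiTwoRaw (hξ : ContMDiff (𝓡 4) (𝓡 4).tangent ∞ fun x => (⟨x, ξ x⟩ : TangentBundle (𝓡 4) X))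
    (h : IsRegularLevel (𝓡 4) f a) (φ : RegularLevel h → ℝ) (h₂ TP χlo χhi w ρ R₀ : ℝ → ℝ)
    (Spl Sbot Smin Psw c₀ ε κ aR : ℝ) (z : X) : ℝ :=
  (f z - a) * (H.topHeightBot hξ h φ h₂ TP χlo χhi Spl Sbot Smin Psw z - (f z - a)) *
    H.weight hξ h φ w ρ c₀ ε κ aR z * H.radial R₀ z

/-- **The second sector's function `ψ₂ = 1 - C Ψ₂`.** [cite: GayKirby2016, §4, Lemma 14] -/
def psiTwo (hξ : ContMDiff (𝓡 4) (𝓡 4).tangent ∞ fun x => (⟨x, ξ x⟩ : TangentBundle (𝓡 4) X))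
    (h : IsRegularLevel (𝓡 4) f a) (φ : RegularLevel h → ℝ) (h₂ TP χlo χhi w ρ R₀ : ℝ → ℝ)
    (Spl Sbot Smin Psw c₀ ε κ aR C : ℝ) (z : X) : ℝ :=
  1 - C * H.psiTwoRaw hξ h φ h₂ TP χlo χhi w ρ R₀ Spl Sbot Smin Psw c₀ ε κ aR z

/-- **`Ψ₂` is smooth on the band** (where `T`, `W`, `R` are). [cite: GayKirby2016, §4, Lemma 14] -/
theorem contMDiffAt_psiTwoRaw (hfM : IsMorse (𝓡 4) f)
    (hT : ContMDiff (𝓡 4) 𝓘(ℝ, ℝ) ∞ (H.topHeightBot hξ h φ h₂ TP χlo χhi Spl Sbot Smin Psw))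
    {z : X} (hW : ContMDiffAt (𝓡 4) 𝓘(ℝ, ℝ) ∞ (H.weight hξ h φ w ρ c₀ ε κ aR) z)
    (hR : ContMDiffAt (𝓡 4) 𝓘(ℝ, ℝ) ∞ (H.radial R₀) z) :
    ContMDiffAt (𝓡 4) 𝓘(ℝ, ℝ) ∞ (H.psiTwoRaw hξ h φ h₂ TP χlo χhi w ρ R₀ Spl Sbot Smin Psw c₀ ε κ aR) z := by
  have hs : ContMDiffAt (𝓡 4) 𝓘(ℝ, ℝ) ∞ (fun z => f z - a) z := (hfM.contMDiff z).sub contMDiffAt_const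
  exact ((hs.mul ((hT z).sub hs)).mul hW).mul hR

/-- `ψ₂` is smooth where `Ψ₂` is. [folklore] -/
theorem contMDiffAt_psiTwo {C : ℝ} {z : X}
    (hΨ : ContMDiffAt (𝓡 4) 𝓘(ℝ, ℝ) ∞ (H.psiTwoRaw hξ h φ h₂ TP χlo χhi w ρ R₀ Spl Sbot Smin Psw c₀ ε κ aR) z) :
    ContMDiffAt (𝓡 4) 𝓘(ℝ, ℝ) ∞ (H.psiTwo hξ h φ h₂ TP χlo χhi w ρ R₀ Spl Sbot Smin Psw c₀ ε κ aR C) z :=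
  contMDiffAt_const.sub (contMDiffAt_const.mul hΨ)

/-! ### The weight and the radial correction near a point off the chart zones -/

/-- **`W = w(φ̄)` near a band point all of whose chart coordinates have `A_j > a_R/2`** (the
two recipes agree on the shell). [cite: GayKirby2016, §4, Lemma 14] -/
theorem weight_eventuallyEq_w_flowLift (hgl : IsGradientLike (𝓡 4) f ξ) (hfM : IsMorse (𝓡 4) f)
    (hε : 0 ≤ ε) (hκ : 0 ≤ κ) {δ' : ℝ} (haR2 : 2 * aR ≤ η)
    (hρ : ∀ A, aR / 2 ≤ A → A ≤ 2 * aR → ρ A = A⁻¹)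
    (hκδ : κ / η * (2 * aR) * (2 * η) < 2 * δ')
    (hφ : ∀ j (y : RegularLevel h), y.1 ∈ (H.box j).chart.source →
      TubeModel.tube ε κ η ((H.box j).coord y.1) < 1 + 2 * δ' →
      φ y = c₀ * TubeModel.tube ε κ η ((H.box j).coord y.1))
    {z : X} (hf₂ : f z < a + 2 * η) (hA : ∀ j, z ∈ (H.box j).chart.source → aR / 2 < H.A j z) :
    H.weight hξ h φ w ρ c₀ ε κ aR =ᶠ[𝓝 z] fun z' => w (flowLift hξ h φ z') := by
  have hη := H.eta_pos
  have hcontf : Continuous f := hfM.contMDiff.continuous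
  have hband : ∀ᶠ w' in 𝓝 z, f w' < a + 2 * η := hcontf.continuousAt.eventually (Iio_mem_nhds hf₂)
  -- for each `i`, near `z`: `w' ∈ zone aR i → weight w' = w (φ̄ w')`
  have hev : ∀ i, ∀ᶠ w' in 𝓝 z, w' ∈ H.zone aR i →
      w (c₀ * H.tubeHat ε κ ρ i w') = w (flowLift hξ h φ w') := by
    intro i
    by_cases hi : z ∈ (H.box i).chart.source
    · have hcA : ContinuousAt (H.A i) z :=
        (H.continuousOn_A i).continuousAt ((H.box i).chart.open_source.mem_nhds hi)
      filter_upwards [hcA.eventually (Ioi_mem_nhds (hA i hi)), hband] with w' hA'' hf' hzone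
      have hA' : aR / 2 < H.A i w' := hA''
      have hAlt : H.A i w' < aR := hzone.2
      have hApos : 0 < H.A i w' := by linarith [hA'.le, show 0 < aR by linarith]
      have hP : κ / η * H.P i w' < 2 * δ' := by
        have hB : H.B i w' < 2 * η := by have := H.apply_eq hzone.1; linarith [H.A_nonneg i w']
        have hPle : H.P i w' ≤ 2 * aR * (2 * η) := by
          rw [P_def]; exact mul_le_mul (by linarith) hB.le (H.B_nonneg i w') (by linarith)
        have h1 := mul_le_mul_of_nonneg_left hPle (div_nonneg hκ hη.le)
        linarith
      exact (H.w_flowLift_eq_of_mem_shell hgl hfM hε hφ hzone.1 (by linarith) hApos hf' hP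
        (hρ _ (le_of_lt hA') (by linarith))).symm
    · filter_upwards [H.eventually_not_mem_zone_of_not_mem_source (show aR ≤ η by linarith) hcontf hi hf₂] with w' hw' hzone
      exact absurd hzone hw'
  filter_upwards [Filter.eventually_all.2 hev] with w' hw'
  by_cases hz : ∃ j, w' ∈ H.zone aR j
  · obtain ⟨j, hj⟩ := hz
    rw [H.weight_of_mem_zone hj, hw' j hj]
  · push Not at hz
    exact H.weight_of_forall_not_mem hz

omit [CompactSpace X] [IsManifold (𝓡 4) ∞ X] in
/-- **`R = 1` near a band point all of whose chart coordinates have `A_j > a_R'`.** [folklore] -/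
theorem radial_eventuallyEq_one (hfM : IsMorse (𝓡 4) f) {aR' : ℝ} (haR' : aR' ≤ η)
    (hR₀ : ∀ A, aR' ≤ A → R₀ A = 1) {z : X} (hf₂ : f z < a + 2 * η)
    (hA : ∀ j, z ∈ (H.box j).chart.source → aR' < H.A j z) :
    H.radial R₀ =ᶠ[𝓝 z] fun _ => (1 : ℝ) := by
  have hcontf : Continuous f := hfM.contMDiff.continuous
  have hev : ∀ i, ∀ᶠ w' in 𝓝 z, w' ∈ (H.box i).chart.source → aR' ≤ H.A i w' := by
    intro i
    by_cases hi : z ∈ (H.box i).chart.source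
    · have hcA : ContinuousAt (H.A i) z :=
        (H.continuousOn_A i).continuousAt ((H.box i).chart.open_source.mem_nhds hi)
      filter_upwards [hcA.eventually (Ioi_mem_nhds (hA i hi))] with w' hw' _
      exact le_of_lt hw'
    · filter_upwards [H.eventually_not_mem_zone_of_not_mem_source haR' hcontf hi hf₂] with w' hw' hsrc
      by_contra hlt; push Not at hlt; exact hw' ⟨hsrc, hlt⟩
  filter_upwards [Filter.eventually_all.2 hev] with w' hw'
  exact H.radial_eq_one_of_le hR₀ hw'

/-! ### The top height near a point off the switch cores -/

/-- **`T_bot = h₂(φ̄)` near a hitting point of the plateau all of whose chart coordinates have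
`P_j > 2P₁`** (off the switch sets `T_raw = satLift h₂`; on the collar both are the plateau
value). [cite: GayKirby2016, §4, Lemma 14] -/
theorem topHeightBot_eventuallyEq_h₂_flowLift (hgl : IsGradientLike (𝓡 4) f ξ) (hfM : IsMorse (𝓡 4) f)
    {P₁ v₁ : ℝ} (hPsw0 : 0 < Psw) (hPsw : 2 * Psw ≤ η ^ 2)
    (hTP₂ : ∀ P, 2 * P₁ ≤ P → TP P = Spl) (hh₂v : ∀ t ≤ v₁, h₂ t = Spl)
    (hφv : ∀ j (y : RegularLevel h), y.1 ∈ (H.box j).chart.source → H.P j y.1 < 2 * Psw → φ y ≤ v₁)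
    {z : X} (hf₁ : a - η < f z) (hf₂ : f z < a + 2 * η) (hhit : Hits (flowθ hξ) f a z)
    (hplateau : ∀ᶠ s in 𝓝 (f z - a), χlo s = 1 ∧ χhi s = 1)
    (hP : ∀ j, z ∈ (H.box j).chart.source → 2 * P₁ < H.P j z) :
    H.topHeightBot hξ h φ h₂ TP χlo χhi Spl Sbot Smin Psw =ᶠ[𝓝 z] fun z' => h₂ (flowLift hξ h φ z') := by
  have hcontf : Continuous f := hfM.contMDiff.continuous
  have hband : ∀ᶠ w' in 𝓝 z, a - η < f w' ∧ f w' < a + 2 * η :=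
    (hcontf.continuousAt.eventually (Ioo_mem_nhds hf₁ hf₂)).mono fun w hw => hw
  have hs : Tendsto (fun w' => f w' - a) (𝓝 z) (𝓝 (f z - a)) := (hcontf.continuousAt.sub continuousAt_const).tendsto
  have hpl : ∀ᶠ w' in 𝓝 z, χlo (f w' - a) = 1 ∧ χhi (f w' - a) = 1 := hs.eventually hplateau
  have hhits : ∀ᶠ w' in 𝓝 z, Hits (flowθ hξ) f a w' :=
    (hgl.isOpen_setOf_hits hfM hξ h.forall_not_isMCriticalPt).mem_nhds hhit
  -- for each `i`, near `z`: the raw top height is `h₂(φ̄)` whether in `swSet i` or not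
  have hev : ∀ i, ∀ᶠ w' in 𝓝 z, Hits (flowθ hξ) f a w' → a - η < f w' → f w' < a + 2 * η →
      w' ∈ H.swSet Psw i → TP (H.P i w') = h₂ (flowLift hξ h φ w') := by
    intro i
    by_cases hi : z ∈ (H.box i).chart.source
    · have hcP : ContinuousAt (H.P i) z :=
        (H.continuousOn_P i).continuousAt ((H.box i).chart.open_source.mem_nhds hi)
      filter_upwards [hcP.eventually (Ioi_mem_nhds (hP i hi))] with w' hw'' hh hf₁' hf₂' hsw
      have hw' : 2 * P₁ < H.P i w' := hw''
      have hlt : H.P i w' < 2 * Psw := by linarith [hsw.2]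
      rw [hTP₂ _ (le_of_lt hw'), hh₂v _ (H.flowLift_le_of_P_lt hgl hfM hPsw (hφv i) hsw.1 hlt hf₁' hf₂' hh)]
    · filter_upwards [H.eventually_not_mem_swSet_of_not_mem_source (show Psw ≤ η ^ 2 by nlinarith) hcontf hi hf₁ hf₂]
        with w' hw' _ _ _ hsw
      exact absurd hsw hw'
  filter_upwards [Filter.eventually_all.2 hev, hband, hpl, hhits] with w' hw' hwf hwpl hwh
  rw [H.topHeightBot_of_eq_one hwpl.1 hwpl.2]
  by_cases hsw : ∃ j, w' ∈ H.swSet Psw j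
  · obtain ⟨j, hj⟩ := hsw
    rw [H.topRaw_of_mem_swSet hj, hw' j hwh hwf.1 hwf.2 hj]
  · push Not at hsw
    rw [H.topRaw_of_forall_not_mem_of_hits hsw hwh]

/-! ### The flow-rule form of `Ψ₂` -/

/-- **In the flow-rule region `Ψ₂ = Γ₂(φ̄, f)` near the point**, with
`Γ₂(p, q) = (q - a) (h₂(p) - (q - a)) w(p)`. [cite: GayKirby2016, §4, Lemma 14] -/
theorem psiTwoRaw_eventuallyEq_flowRule (hgl : IsGradientLike (𝓡 4) f ξ) (hfM : IsMorse (𝓡 4) f)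
    (hε : 0 ≤ ε) (hκ : 0 ≤ κ) {δ' P₁ v₁ aR' : ℝ} (hPsw : 2 * Psw ≤ η ^ 2)
    (hTP₂ : ∀ P, 2 * P₁ ≤ P → TP P = Spl) (hh₂v : ∀ t ≤ v₁, h₂ t = Spl)
    (hφv : ∀ j (y : RegularLevel h), y.1 ∈ (H.box j).chart.source → H.P j y.1 < 2 * Psw → φ y ≤ v₁)
    (hPsw0 : 0 < Psw) (haR2 : 2 * aR ≤ η) (hρ : ∀ A, aR / 2 ≤ A → A ≤ 2 * aR → ρ A = A⁻¹)
    (hκδ : κ / η * (2 * aR) * (2 * η) < 2 * δ')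
    (hφ : ∀ j (y : RegularLevel h), y.1 ∈ (H.box j).chart.source →
      TubeModel.tube ε κ η ((H.box j).coord y.1) < 1 + 2 * δ' →
      φ y = c₀ * TubeModel.tube ε κ η ((H.box j).coord y.1))
    (haR' : aR' ≤ η) (hR₀ : ∀ A, aR' ≤ A → R₀ A = 1)
    {z : X} (hf₁ : a - η < f z) (hf₂ : f z < a + 2 * η) (hhit : Hits (flowθ hξ) f a z)
    (hplateau : ∀ᶠ s in 𝓝 (f z - a), χlo s = 1 ∧ χhi s = 1)
    (hreg : ∀ j, z ∈ (H.box j).chart.source → 2 * P₁ < H.P j z ∧ aR / 2 < H.A j z ∧ aR' < H.A j z) :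
    H.psiTwoRaw hξ h φ h₂ TP χlo χhi w ρ R₀ Spl Sbot Smin Psw c₀ ε κ aR =ᶠ[𝓝 z] fun z' =>
      (fun r : ℝ × ℝ => (r.2 - a) * (h₂ r.1 - (r.2 - a)) * w r.1) (flowLift hξ h φ z', f z') := by
  filter_upwards [H.topHeightBot_eventuallyEq_h₂_flowLift (Sbot := Sbot) (Smin := Smin) hgl hfM hPsw0 hPsw hTP₂ hh₂v hφv
      hf₁ hf₂ hhit hplateau fun j hj => (hreg j hj).1,
    H.weight_eventuallyEq_w_flowLift hgl hfM hε hκ haR2 hρ hκδ hφ hf₂ fun j hj => (hreg j hj).2.1,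
    H.radial_eventuallyEq_one hfM haR' hR₀ hf₂ fun j hj => (hreg j hj).2.2] with z' hT hW hR
  have hW' : H.weight hξ h φ w ρ c₀ ε κ aR z' = w (flowLift hξ h φ z') := hW
  have hT' : H.topHeightBot hξ h φ h₂ TP χlo χhi Spl Sbot Smin Psw z' = h₂ (flowLift hξ h φ z') := hT
  have hR' : H.radial R₀ z' = 1 := hR
  simp only [psiTwoRaw, hT', hW', hR', mul_one]

end HandleBoxes

end Literature.Topology.FourManifolds

end
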